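import Literature.MathematicalPhysics.QuantumLattice.SublatticeViewsCellEnergyBridge
import Literature.MathematicalPhysics.QuantumLattice.WeightedOpenClusterBoundsPeriodic
import Literature.MathematicalPhysics.QuantumLattice.EmeryThreeBandByDecoration
import Literature.MathematicalPhysics.QuantumLattice.HubbardTPPBoxHamiltonian
import Literature.MathematicalPhysics.QuantumLattice.OneBandHoppingFamilyMeanEnergyMinimisers
import HarnessLib

/-!
# The three-band (Emery) `CuO₂` model as ONE `2×2`-periodic interaction, and THE CLUSTER FLOOR on its typed energy density:
# a Cu–O cluster certificate `H^w_B + G − q₀ ⪰ 0` gives `(q₀ − …)/(4M) ≤ emeryEnergyDensity θ ρ`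

Topic `Literature/MathematicalPhysics/QuantumLattice` (family `hubbard`; crew hubbard-fast S2 (iv) «multi-band: three-band Emery boxes»).
`EmeryThreeBandByDecoration` types the three-band model by its fourteen VIEW directions `emeryDirections` and the variational density
`emeryEnergyDensity θ ρ = inf {cellEnergy (emeryViews θ) 1 ω : ω ∈ emeryStates ρ}`; the router's Emery boxes (`Downfold/EmeryBoxes*`) take
FLOORS `m ≤ emeryEnergyDensity (emeryLine s w) ρ` at box vertices as their doors — and no producer of such floors exists. This file closes
the chain «cluster certificate ⇒ typed Emery floor»:

* §1 `emeryAtoms` (the fourteen directions as SINGLE `2×2`-periodic interactions: `sublatticeVectorHopping` / `sublatticeOnSite` with the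
  labels of `emeryDirections`) and **`emeryInteraction θ = Φ^{0,0} + Σ_a θ_a · emeryAtoms a`** — ONE interaction, Hermitian, even,
  `liebPeriods`-periodic, of range `1` (`emeryInteraction_structure`);
* §2 **`cellEnergy_emeryViews_eq_cellMeanEnergy`**: `cellEnergy (emeryViews θ) R ω = cellMeanEnergy liebPeriods (emeryInteraction θ) ω R` for
  EVERY state (the bridge `SublatticeViewsCellEnergyBridge`, direction by direction), so `emeryEnergyDensity θ ρ` is the infimum of the
  cell energy density of ONE periodic interaction over `emeryStates ρ`;
* §3 **THE EMERY CLUSTER FLOOR** `le_emeryEnergyDensity_of_posSemidef_reweight`: for a finite window `B ⊆ ℤ²`, an `L_{(2,2)}`-admissible weight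
  `w` of mass `M` for `emeryInteraction θ` (`WeightedOpenClusterBoundsPeriodic`), any `G ∈ 𝔄_B` killed by every `2×2`-periodic state, and an
  operator certificate `H^{w}_B[emeryInteraction θ] + G − q₀·1 ⪰ 0` on the cluster Fock space:
  `(q₀ − w(∅)·(Ψ∅)_{∅∅}) / (4M) ≤ emeryEnergyDensity θ ρ` for every `ρ` with `emeryStates ρ` nonempty — the weighted Anderson bound for the
  decorated `CuO₂` lattice (e.g. `B` = a `Cu₂O₇`- or `2 × 1`-cell window; `4 = |C|` cell points incl. the dummy).

Everything is PROVED; definitions with bodies: `emeryAtoms`, `emeryInteraction`; no named fact, no number. HONEST SCOPE: a floor law; it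
certifies nothing by itself (the PSD hypothesis is what a kernel / interval cluster certificate asserts); chemical-potential tilts enter through
`θ` (directions 8–10 are the Cu / O site energies) and density brackets through the box calculus of `EmeryThreeBandByDecoration`.

## Mathlib / tree search

REUSED: `emeryDirections`, `emeryViews`, `emeryStates`, `emeryEnergyDensity`, `liebPeriods`, `cuSite/oxSite/oySite`, `ppVec(_ne_zero)`,
`uvec_ne_zero` (`EmeryThreeBandByDecoration`); `cellEnergy_sublatticeVectorHoppingViews_eq_cellMeanEnergy`, `…OnSiteViews…`,
`cellEnergy_const_eq_cellMeanEnergy`, `cellEnergy_viewFamily_eq_cellMeanEnergy_linearFamily`, `le_infCellEnergyOn_of_forall_cellMeanEnergy`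
(`SublatticeViewsCellEnergyBridge`); `IsPeriodic.le_mul_cellMeanEnergy_of_posSemidef_reweight` (`WeightedOpenClusterBoundsPeriodic`);
`isHermitian/isEven/isPeriodic/hasFiniteRange_linearFamily`, `sublatticeVectorHopping_*`, `sublatticeOnSite_*` structure lemmas; `card_cell_two`.
`lean search 'emeryInteraction|emeryAtoms|emery.*PosSemidef'` (2026-08-28): nothing.

## References

* V. J. Emery, Phys. Rev. Lett. 58 (1987) 2794, via E. Pavarini et al., Phys. Rev. Lett. 87 (2001) 047003, eq. (1). [cite: PavariniEtAl2001, eq. (1)]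
* P. W. Anderson, Phys. Rev. 83 (1951) 1260, eq. (2). [cite: Anderson1951, eq. (2)]
* R. Valentí, J. Stolze, P. J. Hirschfeld, Phys. Rev. B 43 (1991) 13743, §II. [cite: ValentiStolzeHirschfeld1991, §II]
* H. Araki, H. Moriya, Rev. Math. Phys. 15 (2003) 93, §4.1 Def. 4.5. [cite: ArakiMoriya2003, §4.1 Def. 4.5]
-/

noncomputable section

open scoped ComplexOrder BigOperators
open Finset

namespace Literature.MathematicalPhysics.QuantumLattice

open Matrix HubbardWave0 Literature.Probability.LatticeModels ThermodynamicLimit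
open scoped Matrix.Norms.L2Operator

/-! ### §1 The three-band model as ONE periodic interaction -/

/-- **The fourteen directions of the decorated `CuO₂` model as SINGLE `2×2`-periodic interactions** (same order and labels as
`emeryDirections`: Cu–O bonds `e₁` from Cu / from O_x, `e₂` from Cu / from O_y; the four O_x–O_y bonds; site energies Cu, O_x, O_y;
repulsions Cu, O_x, O_y). [cite: PavariniEtAl2001, eq. (1)] -/
def emeryAtoms : Fin 14 → FermionInteraction 2 :=
  ![sublatticeVectorHopping liebPeriods cuSite (unitVec 0) 1,
    sublatticeVectorHopping liebPeriods oxSite (unitVec 0) 1,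
    sublatticeVectorHopping liebPeriods cuSite (unitVec 1) 1,
    sublatticeVectorHopping liebPeriods oySite (unitVec 1) 1,
    sublatticeVectorHopping liebPeriods oxSite (ppVec 0) 1,
    sublatticeVectorHopping liebPeriods oxSite (ppVec 1) 1,
    sublatticeVectorHopping liebPeriods oxSite (ppVec 2) 1,
    sublatticeVectorHopping liebPeriods oxSite (ppVec 3) 1,
    sublatticeOnSite liebPeriods cuSite 1 0,
    sublatticeOnSite liebPeriods oxSite 1 0,
    sublatticeOnSite liebPeriods oySite 1 0,
    sublatticeOnSite liebPeriods cuSite 0 1,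
    sublatticeOnSite liebPeriods oxSite 0 1,
    sublatticeOnSite liebPeriods oySite 0 1]

/-- **The three-band (Emery) model at coupling vector `θ ∈ ℝ¹⁴` as ONE `2×2`-periodic interaction**: `Φ^{0,0} + Σ_a θ_a · emeryAtoms a`
(base: the empty Hubbard interaction, as in `emeryViews`). [cite: PavariniEtAl2001, eq. (1)] -/
def emeryInteraction (θ : Fin 14 → ℝ) : FermionInteraction 2 :=
  FermionInteraction.linearFamily (hubbardFermionInteraction 2 0 0) emeryAtoms θ

/-- `‖e_i‖ ≤ 1` in the sup norm of `ℤ²`. [cite: FriedliVelenik2017, §3.2] -/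
theorem norm_unitVec_two_le_one (i : Fin 2) : ‖(unitVec i : Site 2)‖ ≤ 1 := by
  refine (pi_norm_le_iff_of_nonneg zero_le_one).2 fun j => ?_
  fin_cases i <;> fin_cases j <;> simp [unitVec]

/-- `‖ppVec k‖ ≤ 1` in the sup norm of `ℤ²`. [cite: FriedliVelenik2017, §3.2] -/
theorem norm_ppVec_le_one (k : Fin 4) : ‖ppVec k‖ ≤ 1 := by
  refine (pi_norm_le_iff_of_nonneg zero_le_one).2 fun j => ?_
  fin_cases k <;> fin_cases j <;> simp [ppVec, unitVec]

/-- Every Emery atom is Hermitian, even, `2×2`-periodic and of range `1`. [cite: ArakiMoriya2003, §1 assumptions (II), (IV) and §5.4] -/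
theorem emeryAtoms_structure (a : Fin 14) :
    (emeryAtoms a).IsHermitian ∧ (emeryAtoms a).IsEven ∧ (emeryAtoms a).IsPeriodic liebPeriods ∧ (emeryAtoms a).HasFiniteRange 1 := by
  have hhop : ∀ (c v : Site 2), v ≠ 0 → ‖v‖ ≤ 1 →
      (sublatticeVectorHopping liebPeriods c v 1).IsHermitian ∧ (sublatticeVectorHopping liebPeriods c v 1).IsEven ∧
        (sublatticeVectorHopping liebPeriods c v 1).IsPeriodic liebPeriods ∧ (sublatticeVectorHopping liebPeriods c v 1).HasFiniteRange 1 :=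
    fun c v hv hn => ⟨sublatticeVectorHopping_isHermitian _ _ _ _, sublatticeVectorHopping_isEven _ _ _ _,
      sublatticeVectorHopping_isPeriodic _ _ hv _, (sublatticeVectorHopping_hasFiniteRange _ _ _).of_le hn⟩
  have hsite : ∀ (c : Site 2) (ε U : ℝ),
      (sublatticeOnSite liebPeriods c ε U).IsHermitian ∧ (sublatticeOnSite liebPeriods c ε U).IsEven ∧
        (sublatticeOnSite liebPeriods c ε U).IsPeriodic liebPeriods ∧ (sublatticeOnSite liebPeriods c ε U).HasFiniteRange 1 :=
    fun c ε U => ⟨sublatticeOnSite_isHermitian _ _ _ _, sublatticeOnSite_isEven _ _ _ _, sublatticeOnSite_isPeriodic _ _ _ _,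
      sublatticeOnSite_hasFiniteRange _ _ _ _ 1 zero_le_one⟩
  fin_cases a
  · exact hhop _ _ (uvec_ne_zero 0) (norm_unitVec_two_le_one 0)
  · exact hhop _ _ (uvec_ne_zero 0) (norm_unitVec_two_le_one 0)
  · exact hhop _ _ (uvec_ne_zero 1) (norm_unitVec_two_le_one 1)
  · exact hhop _ _ (uvec_ne_zero 1) (norm_unitVec_two_le_one 1)
  · exact hhop _ _ (ppVec_ne_zero 0) (norm_ppVec_le_one 0)
  · exact hhop _ _ (ppVec_ne_zero 1) (norm_ppVec_le_one 1)
  · exact hhop _ _ (ppVec_ne_zero 2) (norm_ppVec_le_one 2)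
  · exact hhop _ _ (ppVec_ne_zero 3) (norm_ppVec_le_one 3)
  · exact hsite _ _ _
  · exact hsite _ _ _
  · exact hsite _ _ _
  · exact hsite _ _ _
  · exact hsite _ _ _
  · exact hsite _ _ _

/-- **Structure of the three-band interaction**: Hermitian, even, `2×2`-periodic, range `1` — the four inputs of the periodic `T ≥ 0` theory
(`PeriodicVariationalPressure`, `PeriodicGibbsVariationalPrinciple`, `WeightedOpenClusterBoundsPeriodic`).
[cite: ArakiMoriya2003, §1 assumptions (II), (IV) and §5.4] -/
theorem emeryInteraction_structure (θ : Fin 14 → ℝ) :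
    (emeryInteraction θ).IsHermitian ∧ (emeryInteraction θ).IsEven ∧ (emeryInteraction θ).IsPeriodic liebPeriods ∧
      (emeryInteraction θ).HasFiniteRange 1 :=
  ⟨FermionInteraction.isHermitian_linearFamily (hubbardFermionInteraction_isHermitian 0 0) (fun a => (emeryAtoms_structure a).1) _,
    FermionInteraction.isEven_linearFamily (hubbardFermionInteraction_isEven 0 0) (fun a => (emeryAtoms_structure a).2.1) _,
    FermionInteraction.isPeriodic_linearFamily ((hubbardFermionInteraction_isTranslationInvariant 0 0).isPeriodic _)
      (fun a => (emeryAtoms_structure a).2.2.1) _,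
    FermionInteraction.hasFiniteRange_linearFamily (hubbardFermionInteraction_hasFiniteRange 0 0)
      (fun a => (emeryAtoms_structure a).2.2.2) _⟩

/-! ### §2 The views and the single interaction have the same cell energy, state by state -/

namespace InfVolFermionState

/-- **Direction by direction**: `cellEnergy (emeryDirections a) R ω = cellMeanEnergy liebPeriods (emeryAtoms a) ω R` for every state.
[cite: ArakiMoriya2003, §4.1 Def. 4.5] [cite: PavariniEtAl2001, eq. (1)] -/
theorem cellEnergy_emeryDirections_eq_cellMeanEnergy (a : Fin 14) (R : ℝ) (ω : InfVolFermionState 2) :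
    ω.cellEnergy (emeryDirections a) R = cellMeanEnergy liebPeriods (emeryAtoms a) ω R := by
  fin_cases a
  · exact cellEnergy_sublatticeVectorHoppingViews_eq_cellMeanEnergy _ (uvec_ne_zero 0) _ R ω
  · exact cellEnergy_sublatticeVectorHoppingViews_eq_cellMeanEnergy _ (uvec_ne_zero 0) _ R ω
  · exact cellEnergy_sublatticeVectorHoppingViews_eq_cellMeanEnergy _ (uvec_ne_zero 1) _ R ω
  · exact cellEnergy_sublatticeVectorHoppingViews_eq_cellMeanEnergy _ (uvec_ne_zero 1) _ R ω
  · exact cellEnergy_sublatticeVectorHoppingViews_eq_cellMeanEnergy _ (ppVec_ne_zero 0) _ R ω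
  · exact cellEnergy_sublatticeVectorHoppingViews_eq_cellMeanEnergy _ (ppVec_ne_zero 1) _ R ω
  · exact cellEnergy_sublatticeVectorHoppingViews_eq_cellMeanEnergy _ (ppVec_ne_zero 2) _ R ω
  · exact cellEnergy_sublatticeVectorHoppingViews_eq_cellMeanEnergy _ (ppVec_ne_zero 3) _ R ω
  · exact cellEnergy_sublatticeOnSiteViews_eq_cellMeanEnergy _ _ _ R ω
  · exact cellEnergy_sublatticeOnSiteViews_eq_cellMeanEnergy _ _ _ R ω
  · exact cellEnergy_sublatticeOnSiteViews_eq_cellMeanEnergy _ _ _ R ω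
  · exact cellEnergy_sublatticeOnSiteViews_eq_cellMeanEnergy _ _ _ R ω
  · exact cellEnergy_sublatticeOnSiteViews_eq_cellMeanEnergy _ _ _ R ω
  · exact cellEnergy_sublatticeOnSiteViews_eq_cellMeanEnergy _ _ _ R ω

/-- **THE THREE-BAND VIEWS ARE ONE PERIODIC INTERACTION**: `cellEnergy (emeryViews θ) R ω = cellMeanEnergy liebPeriods (emeryInteraction θ) ω R`
for EVERY state `ω` and every `θ`. [cite: ArakiMoriya2003, §4.1 Def. 4.5] [cite: PavariniEtAl2001, eq. (1)] -/
theorem cellEnergy_emeryViews_eq_cellMeanEnergy (θ : Fin 14 → ℝ) (R : ℝ) (ω : InfVolFermionState 2) :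
    ω.cellEnergy (emeryViews θ) R = cellMeanEnergy liebPeriods (emeryInteraction θ) ω R :=
  cellEnergy_viewFamily_eq_cellMeanEnergy_linearFamily
    (cellEnergy_const_eq_cellMeanEnergy (hubbardFermionInteraction_isTranslationInvariant 0 0) R ω)
    (fun a => cellEnergy_emeryDirections_eq_cellMeanEnergy a R ω) θ

/-- **The typed three-band density is the infimum of ONE interaction's cell energy density**: every floor `m ≤ ē(emeryInteraction θ)(ω)`
valid for all `ω ∈ emeryStates ρ` is a floor `m ≤ emeryEnergyDensity θ ρ`. [cite: BratteliKishimotoRobinson1978, Thm. 2 (condition 2)] -/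
theorem le_emeryEnergyDensity_of_forall_cellMeanEnergy (θ : Fin 14 → ℝ) {ρ : ℝ} (hS : (emeryStates ρ).Nonempty) {m : ℝ}
    (hm : ∀ ω ∈ emeryStates ρ, m ≤ cellMeanEnergy liebPeriods (emeryInteraction θ) ω 1) : m ≤ emeryEnergyDensity θ ρ :=
  le_infCellEnergyOn_of_forall_cellMeanEnergy hS (fun ω _ => cellEnergy_emeryViews_eq_cellMeanEnergy θ 1 ω) hm

/-! ### §3 The cluster floor on the typed three-band energy density -/

/-- The `2×2` cell has four points (restated privately; the Downfold tree has `card_cell_lieb`). [folklore] -/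
private theorem card_cell_liebPeriods : Fintype.card (Cell liebPeriods) = 4 := by
  rw [card_cell_two]; rfl

/-- **THE EMERY CLUSTER FLOOR.** Let `B ⊆ ℤ²` be a finite window, `w` an `L_{(2,2)}`-admissible weight of mass `M > 0` for
`emeryInteraction θ` (for every cell point `c` and every interacting shape `X ∋ pos c`, the superlattice translates of `X` inside `B` weigh
`M`), `G ∈ 𝔄_B` killed by every `2×2`-periodic state, and suppose the cluster certificate
`H^{w}_B[emeryInteraction θ] + G − q₀·1 ⪰ 0`. Then `(q₀ − w(∅)(Ψ∅)_{∅∅})/(4M) ≤ emeryEnergyDensity θ ρ` for every `ρ` whose class is nonempty.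
[cite: Anderson1951, eq. (2)] [cite: ValentiStolzeHirschfeld1991, §II] -/
theorem le_emeryEnergyDensity_of_posSemidef_reweight (θ : Fin 14 → ℝ) {ρ : ℝ} (hS : (emeryStates ρ).Nonempty)
    (B : Finset (Site 2)) (w : Finset (Site 2) → ℝ) {M : ℝ} (hM : 0 < M)
    (hw : ∀ (c : Cell liebPeriods) (X : Finset (Site 2)), cellPos c ∈ X → (emeryInteraction θ).Φ X ≠ 0 →
      ∑ y ∈ B with (cellRes liebPeriods y = c ∧ shiftSet (y - cellPos c) X ⊆ B), w (shiftSet (y - cellPos c) X) = M)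
    {G : FermionOp B} (hG0 : ∀ ω' : InfVolFermionState 2, ω'.IsPeriodic liebPeriods → (ω'.expect B G).re = 0) {q₀ : ℝ}
    (hq : ((⟨fun X => (w X : ℂ) • (emeryInteraction θ).Φ X⟩ : FermionInteraction 2).localHamiltonian B + G -
      (q₀ : ℂ) • (1 : FermionOp B)).PosSemidef) :
    (q₀ - w ∅ * (((emeryInteraction θ).Φ ∅) ∅ ∅).re) / (4 * M) ≤ emeryEnergyDensity θ ρ := by
  refine le_emeryEnergyDensity_of_forall_cellMeanEnergy θ hS fun ω hω => ?_
  have hper : ω.IsPeriodic liebPeriods := hω.1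
  have h := hper.le_mul_cellMeanEnergy_of_posSemidef_reweight (emeryInteraction_structure θ).2.2.1 (emeryInteraction_structure θ).2.2.2
    B w M hw hG0 hq
  rw [card_cell_liebPeriods] at h
  push_cast at h
  rw [div_le_iff₀ (by positivity)]
  linarith

end InfVolFermionState

end Literature.MathematicalPhysics.QuantumLattice

end
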